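import Summits.Ventures.PercRepro.SubdivisionLift

/-!
# C-005 for every subdivision of a multigraph with at most eight parallel classes

The **parallel class** of an edge is its unordered pair of endpoints (`edgeClass`); two edges are
parallel exactly when they have the same class (`parallel_iff_edgeClass_eq`). By pigeonhole, while
more edges are live than there are classes two live edges are parallel, and a parallel step kills
one of them — so every weight vector reduces by parallel steps alone to at most `classCount`
live edges (`exists_reduces_card_liveEdges_le_classCount`). With the lift of
`SubdivisionLift.lean`:

**`C005At_of_classCount_le`**: C-005 at every `p` for every marked multigraph with at most eight
parallel classes, whatever its number of edges; **`C005At_subdivision_of_classCount_le`**: the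
same for every subdivision of such a multigraph.
**`C005At_subdivisionMultiK4`**: every **`K₄`-bundle** — for each pair of the four terminals any
number `m k` of internally disjoint paths of arbitrary lengths — satisfies C-005 at every `p`:
every 4-terminal network that is a union of internally vertex-disjoint terminal-to-terminal paths.
-/

namespace PercRepro

namespace MultiGraph

open Finset

section Classes

variable {V E : Type}

/-- The parallel class of an edge: its unordered pair of endpoints. -/
def edgeClass (G : MultiGraph V E) (e : E) : Sym2 V := s(G.fst e, G.snd e)

/-- Two edges are parallel exactly when they have the same class. -/
theorem parallel_iff_edgeClass_eq (G : MultiGraph V E) (e₁ e₂ : E) :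
    G.Parallel e₁ e₂ ↔ G.edgeClass e₁ = G.edgeClass e₂ := by
  unfold Parallel edgeClass
  rw [Sym2.eq_iff]

variable [Fintype E] [DecidableEq E] [DecidableEq V]

/-- The number of parallel classes of `G`. -/
def classCount (G : MultiGraph V E) : ℕ := (univ.image G.edgeClass).card

/-- **Parallel steps reduce every weight vector to at most `classCount` live edges.** -/
theorem exists_reduces_card_liveEdges_le_classCount (G : MultiGraph V E) (a b c d : V)
    (q : E → ℝ) :
    ∃ q' : E → ℝ, Reduces a b c d (G, q) (G, q') ∧ (liveEdges q').card ≤ G.classCount := by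
  suffices h : ∀ n (q : E → ℝ), (liveEdges q).card = n →
      ∃ q' : E → ℝ, Reduces a b c d (G, q) (G, q') ∧ (liveEdges q').card ≤ G.classCount from
    h _ q rfl
  intro n
  induction n using Nat.strong_induction_on with
  | _ n ih =>
    intro q hq
    by_cases hle : (liveEdges q).card ≤ G.classCount
    · exact ⟨q, Relation.ReflTransGen.refl, hle⟩
    · have hlt : (univ.image G.edgeClass).card < (liveEdges q).card := by
        unfold classCount at hle
        omega
      obtain ⟨e₁, h₁, e₂, h₂, hne, hcls⟩ := exists_ne_map_eq_of_card_lt_of_maps_to hlt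
        fun e _ => mem_image_of_mem G.edgeClass (mem_univ e)
      have hpar : G.Parallel e₁ e₂ := (parallel_iff_edgeClass_eq G e₁ e₂).2 hcls
      have hss := liveEdges_parWeight_ssubset hne (mem_liveEdges.1 h₁) (mem_liveEdges.1 h₂)
      have hlt' : (liveEdges (parWeight q e₁ e₂)).card < n := by
        rw [← hq]
        exact card_lt_card hss
      obtain ⟨q', hred, hcard⟩ := ih _ hlt' (parWeight q e₁ e₂) rfl
      exact ⟨q', Relation.ReflTransGen.head (SPStep.parallel hne hpar) hred, hcard⟩

/-- **C-005 for every marked multigraph with at most eight parallel classes** (any multiplicities),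
at every weight vector. -/
theorem C005At_of_classCount_le (G : MultiGraph V E) (hG : G.classCount ≤ 8) {p : E → ℝ}
    (hp : IsProb p) (a b c d : V) : G.C005At p a b c d := by
  obtain ⟨q', hred, hcard⟩ := exists_reduces_card_liveEdges_le_classCount G a b c d p
  exact C005At_of_reduces hp hred (hcard.trans hG)

end Classes

section Subdivision

variable {V₀ E₀ : Type} [Fintype E₀] [DecidableEq E₀] [DecidableEq V₀]

/-- **C-005 for every subdivision of every marked multigraph with at most eight parallel
classes**, whatever its number of edges: for every family of path lengths `ℓ`, every weight
vector `p` and all marks `a, b, c, d` among the vertices of `H`. -/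
theorem C005At_subdivision_of_classCount_le (H : MultiGraph V₀ E₀) (hH : H.classCount ≤ 8)
    (ℓ : E₀ → ℕ) (p : SubdivEdge ℓ → ℝ) (hp : IsProb p) (a b c d : V₀) :
    (H.subdivision ℓ).C005At p (Sum.inl a) (Sum.inl b) (Sum.inl c) (Sum.inl d) := by
  obtain ⟨q', hred, hcard⟩ :=
    exists_reduces_card_liveEdges_le_classCount H a b c d (pathProd ℓ p)
  exact C005At_subdivision_of_reduces H ℓ p hp hred (hcard.trans hH)

end Subdivision

section MultiK4

/-- `K₄` with `m k` parallel edges between the `k`-th pair of terminals (the pairs of `K4`). -/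
def multiK4 (m : Fin 6 → ℕ) : MultiGraph (Fin 4) (Σ k : Fin 6, Fin (m k)) where
  fst x := K4.fst x.1
  snd x := K4.snd x.1

/-- The multi-`K₄` has at most six parallel classes. -/
theorem classCount_multiK4_le (m : Fin 6 → ℕ) : (multiK4 m).classCount ≤ 6 := by
  unfold classCount
  have hsub : univ.image (multiK4 m).edgeClass ⊆ univ.image K4.edgeClass := by
    intro c hc
    obtain ⟨x, -, rfl⟩ := mem_image.1 hc
    exact mem_image_of_mem K4.edgeClass (mem_univ x.1)
  refine (card_le_card hsub).trans (card_image_le.trans ?_)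
  simp

/-- **C-005 for `K₄` with arbitrary multiplicities at every `p`** (no subdivision). -/
theorem C005At_multiK4 (m : Fin 6 → ℕ) (q : (Σ k : Fin 6, Fin (m k)) → ℝ) (hq : IsProb q) :
    (multiK4 m).C005At q 0 1 2 3 :=
  C005At_of_classCount_le (multiK4 m) ((classCount_multiK4_le m).trans (by norm_num)) hq 0 1 2 3

/-- **C-005 for every `K₄`-bundle at every `p`**: between each pair of the four terminals any
number `m k` of internally disjoint paths of arbitrary lengths `ℓ (k, j) + 1` — every 4-terminal
network that is a union of internally vertex-disjoint terminal-to-terminal paths. -/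
theorem C005At_subdivisionMultiK4 (m : Fin 6 → ℕ) (ℓ : (Σ k : Fin 6, Fin (m k)) → ℕ)
    (p : SubdivEdge ℓ → ℝ) (hp : IsProb p) :
    ((multiK4 m).subdivision ℓ).C005At p (Sum.inl 0) (Sum.inl 1) (Sum.inl 2) (Sum.inl 3) :=
  C005At_subdivision_of_classCount_le (multiK4 m) ((classCount_multiK4_le m).trans (by norm_num))
    ℓ p hp 0 1 2 3

end MultiK4

end MultiGraph

end PercRepro
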